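import Summits.CriticalPhenomena.SAWScalingLimit.Theorems.SAWReversalUpgradePathUpgradeRSLENoEscape
import Summits.CriticalPhenomena.SAWScalingLimit.Theorems.SAWReversalUpgradePathUpgradeRSLENoReturn
import Summits.CriticalPhenomena.SAWScalingLimit.Theorems.SAWReversalUpgradePathUpgradeRSLEStart
import Summits.CriticalPhenomena.SAWScalingLimit.Theorems.SAWReversalUpgradePathUpgradeRSLEHullPackage
import Summits.CriticalPhenomena.SAWScalingLimit.Theorems.SAWReversalUpgradePathUpgradeRHullHausdorff
import Summits.CriticalPhenomena.SAWScalingLimit.Theorems.SAWReversalUpgradePathUpgradeRRangeBoundAux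
import Summits.CriticalPhenomena.SAWScalingLimit.Theorems.SAWReversalUpgradePathUpgradeRLatticeDictionary
import Literature.Probability.RandomPlanarGeometry.ChordalReversibility
import HarnessLib

/-!
# Assembly phase `phase1_radii` of `stub_returnsDie` — the radius cascade
(crux `PathUpgradeR`, stmt-CriticalPhenomena-18055, route `SAWReversalUpgrade`,
line `bidir_windows`)

Landing target:
`Summits/CriticalPhenomena/SAWScalingLimit/Theorems/SAWReversalUpgradePathUpgradeRAsmRadii.lean`
(`--supports stmt-CriticalPhenomena-18055`; registered anchor `stub_returnsDie_budget`).

The lead's proof of `stub_returnsDie` (returns of the lattice curve towards its endpoints have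
vanishing probability) compares the lattice curve `X δ` in the Dobrushin domain `(D; a, b)` with the
SLE(8/3) reference sample `γ = sleTrace (8/3) ω` seen through the boundary extensions `φ̄`, `φ̄'`
of chordal uniformizers of `(D; a, b)` and of the swapped domain `(D; b, a)`, along a cascade of
deterministic constants.  This file is the FIRST PHASE of that cascade,
`PathUpgradeRAsm.phase1_radii`: from the two lattice no-return hypotheses `H6` (no return to `a`)
and `H7` (no early escape from `b`), a length scale `ℓ`, a budget `β` and a real budget `ηr` with
`ofReal ηr ≤ β`, it produces the radii
`ra, rb, ra', rb', raF, rbF, R2b, rbP, R2a, raP, rbW, rb'', ra''`, the tail index `N`, the horizons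
`T, T'` and the start times `α₀, α₀'`, together with

* the order relations of the cascade (`raF ≤ ra / 4`, `rbP ≤ R2b / 2`, `rbW ≤ rbP / 2`, …);
* seven lattice window bounds (the `H6`/`H7` events at the chosen radii have `P δ`-mass `≤ β`
  for all small mesh `δ`; an event with a `min`-radius is contained in the event with the
  `H6`/`H7` radius, `measure_mono`);
* five SLE reference bounds, LITERALLY the events of the landed quantile lemmas
  `stub_sleNoEscape` (`R2b`), `stub_sleNoReturn` (`R2a`),
  `PathUpgradeRRangeBound.exists_measure_tail_le` (`N`, fed by the transience clause of
  `stub_sleHullPackage stub_hullHausdorff`), `stub_sleStart` forward (`α₀`) and backward (`α₀'`);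
* the two deterministic lattice-dictionary horizon clauses (`stub_latticeDictionary`, part 2) at
  the horizons `T ≥ max N T₀ 1` and `T' ≥ max T₀' 1`.

The registered anchor `stub_returnsDie_budget` splits a budget `η > 0` into `64` equal ENNReal
parts `β = ofReal (η / 64)` with a real representative `ηr = η / 64`.
-/

noncomputable section

open scoped ENNReal NNReal Topology
open MeasureTheory Filter Set Metric
open Literature.Probability Literature.Probability.RandomPlanarGeometry

namespace Summit.CriticalPhenomena.SAWScalingLimit.Theorems

/-- **Budget split** (registered anchor `stub_returnsDie_budget` of crux `PathUpgradeR`, line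
`bidir_windows`): every `η > 0` admits a positive finite ENNReal budget `β` with `64 β ≤ ofReal η`
and a positive real `ηr` with `ofReal ηr ≤ β`; take `β := ofReal (η / 64)` and `ηr := η / 64`.
[folklore] -/
theorem stub_returnsDie_budget : ∀ η : ℝ, 0 < η → ∃ β : ENNReal, 0 < β ∧ β ≠ ⊤ ∧ 64 * β ≤ ENNReal.ofReal η ∧ ∃ ηr : ℝ, 0 < ηr ∧ ENNReal.ofReal ηr ≤ β := by
  intro η hη
  refine ⟨ENNReal.ofReal (η / 64), ENNReal.ofReal_pos.2 (by positivity), ENNReal.ofReal_ne_top,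
    le_of_eq ?_, η / 64, by positivity, le_rfl⟩
  rw [← ENNReal.ofReal_ofNat 64, ← ENNReal.ofReal_mul (by norm_num : (0 : ℝ) ≤ 64)]
  congr 1
  ring

namespace PathUpgradeRAsm

/-- **Phase 1 of the constant cascade of `stub_returnsDie` (radii).**  Given the Dobrushin domain
`D` with chordal uniformizers `φ` of `(D; a, b)` and `φ'` of the swapped domain `(D; b, a)`, the
lattice family `(X δ, P δ)`, the lattice hypotheses `H6` (no return to `a = D.pt 0`) and `H7`
(no early escape from `b = D.pt 1`), a scale `ℓ > 0`, a budget `β > 0` and a real budget `ηr > 0`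
with `ofReal ηr ≤ β`, there are radii `ra rb ra' rb' raF rbF R2b rbP R2a raP rbW rb'' ra''`, a tail
index `N`, horizons `T T'` and start times `α₀ α₀'` satisfying the order relations of the cascade,
the seven lattice window bounds (`H6`/`H7` at the chosen radii, mass `≤ β` eventually in `δ`), the
five SLE(8/3) reference bounds (`stub_sleNoEscape`, `stub_sleNoReturn`, the range tail
`PathUpgradeRRangeBound.exists_measure_tail_le`, `stub_sleStart` forward and backward) and the two
lattice-dictionary horizon clauses (`stub_latticeDictionary`).  Routine bookkeeping: successive
choices `min`/`max` of the outputs of the landed lemmas. [folklore] -/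
theorem phase1_radii : ∀ (D : Literature.Probability.RandomPlanarGeometry.DobrushinDomain) (φ : Literature.Probability.RandomPlanarGeometry.ConformalEquiv UpperHalfPlane.upperHalfPlaneSet D.carrier), D.IsChordalUniformizing φ → ∀ (φ' : Literature.Probability.RandomPlanarGeometry.ConformalEquiv UpperHalfPlane.upperHalfPlaneSet D.swap.carrier), D.swap.IsChordalUniformizing φ' → ∀ (Ω : ℝ → Type) [∀ δ, MeasurableSpace (Ω δ)] (X : (δ : ℝ) → Ω δ → Literature.Probability.RandomPlanarGeometry.Curve ℂ) (P : (δ : ℝ) → MeasureTheory.Measure (Ω δ)), (∀ ε : ℝ, 0 < ε → ∀ η : ℝ, 0 < η → ∃ r : ℝ, 0 < r ∧ ∀ᶠ δ in (nhdsWithin (0:ℝ) (Set.Ioi 0)), P δ {ω | ∃ s t : unitInterval, s < t ∧ ε ≤ dist (X δ ω s) (D.pt 0) ∧ dist (X δ ω t) (D.pt 0) ≤ r} ≤ ENNReal.ofReal η) → (∀ ε : ℝ, 0 < ε → ∀ η : ℝ, 0 < η → ∃ r : ℝ, 0 < r ∧ ∀ᶠ δ in (nhdsWithin (0:ℝ)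 (Set.Ioi 0)), P δ {ω | ∃ s t : unitInterval, s < t ∧ dist (X δ ω s) (D.pt 1) ≤ r ∧ ε ≤ dist (X δ ω t) (D.pt 1)} ≤ ENNReal.ofReal η) → ∀ ℓ : ℝ, 0 < ℓ → ∀ β : ENNReal, 0 < β → ∀ ηr : ℝ, 0 < ηr → ENNReal.ofReal ηr ≤ β → ∃ (ra rb ra' rb' raF rbF R2b rbP R2a raP rbW rb'' ra'' : ℝ) (N : ℕ) (T T' : NNReal) (α₀ α₀' : ℝ), (0 < ra) ∧ (ra ≤ ℓ) ∧ (0 < rb) ∧ (rb ≤ ℓ) ∧ (0 < ra') ∧ (0 < rb') ∧ (0 < raF) ∧ (raF ≤ ra / 4) ∧ (raF ≤ ra') ∧ (0 < rbF) ∧ (rbF ≤ rb / 4) ∧ (rbF ≤ rb') ∧ (0 < R2b) ∧ (0 < rbP) ∧ (rbP ≤ R2b / 2) ∧ (rbP ≤ rbF) ∧ (0 < R2a) ∧ (0 < raP) ∧ (raP ≤ R2a / 2) ∧ (raP ≤ raF) ∧ (0 < rbW) ∧ (rbW ≤ rbP / 2) ∧ (0 < rb'') ∧ (0 < ra'') ∧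 (0 < T) ∧ ((N : ℝ) ≤ T) ∧ (1 ≤ (T : ℝ)) ∧ (0 < T') ∧ (1 ≤ (T' : ℝ)) ∧ (0 < α₀) ∧ (0 < α₀') ∧ (∀ᶠ δ in (nhdsWithin (0:ℝ) (Set.Ioi 0)), P δ {ω | ∃ s t : unitInterval, s < t ∧ ℓ / 2 ≤ dist (X δ ω s) (D.pt 0) ∧ dist (X δ ω t) (D.pt 0) ≤ ra} ≤ β) ∧ (∀ᶠ δ in (nhdsWithin (0:ℝ) (Set.Ioi 0)), P δ {ω | ∃ s t : unitInterval, s < t ∧ dist (X δ ω s) (D.pt 1) ≤ rb ∧ ℓ / 2 ≤ dist (X δ ω t) (D.pt 1)} ≤ β) ∧ (∀ᶠ δ in (nhdsWithin (0:ℝ) (Set.Ioi 0)), P δ {ω | ∃ s t : unitInterval, s < t ∧ ra / 4 ≤ dist (X δ ω s) (D.pt 0) ∧ dist (X δ ω t) (D.pt 0) ≤ ra'} ≤ β) ∧ (∀ᶠ δ in (nhdsWithin (0:ℝ) (Set.Ioi 0)), P δ {ω | ∃ s t : unitInterval, s < t ∧ dist (X δ ω s) (D.pt 1) ≤ rb'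 ∧ rb / 4 ≤ dist (X δ ω t) (D.pt 1)} ≤ β) ∧ (∀ᶠ δ in (nhdsWithin (0:ℝ) (Set.Ioi 0)), P δ {ω | ∃ s t : unitInterval, s < t ∧ dist (X δ ω s) (D.pt 1) ≤ rbW ∧ rbP ≤ dist (X δ ω t) (D.pt 1)} ≤ β) ∧ (∀ᶠ δ in (nhdsWithin (0:ℝ) (Set.Ioi 0)), P δ {ω | ∃ s t : unitInterval, s < t ∧ dist (X δ ω s) (D.pt 1) ≤ rb'' ∧ rbW ≤ dist (X δ ω t) (D.pt 1)} ≤ β) ∧ (∀ᶠ δ in (nhdsWithin (0:ℝ) (Set.Ioi 0)), P δ {ω | ∃ s t : unitInterval, s < t ∧ raP ≤ dist (X δ ω s) (D.pt 0) ∧ dist (X δ ω t) (D.pt 0) ≤ ra''} ≤ β) ∧ (Literature.Probability.Process.preWienerMeasure {ω | ∃ u u' : NNReal, u ≤ u' ∧ rbF / 2 < dist (φ.boundaryExtension (Literature.Probability.RandomPlanarGeometry.sleTrace ((8:NNReal)/3) ω u')) (D.pt 1) ∧ dist (φ.boundaryExtension (Literature.Probability.RandomPlanarGeometry.sleTrace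 ((8:NNReal)/3) ω u)) (D.pt 1) < R2b} ≤ β) ∧ (Literature.Probability.Process.preWienerMeasure {ω | ∃ u' u : NNReal, u' ≤ u ∧ raF / 2 < dist (φ.boundaryExtension (Literature.Probability.RandomPlanarGeometry.sleTrace ((8:NNReal)/3) ω u')) (D.pt 0) ∧ dist (φ.boundaryExtension (Literature.Probability.RandomPlanarGeometry.sleTrace ((8:NNReal)/3) ω u)) (D.pt 0) < R2a} ≤ β) ∧ (Literature.Probability.Process.preWienerMeasure {ω | ∃ t : NNReal, ((N : ℕ) : NNReal) ≤ t ∧ rbW / 2 < dist (φ.boundaryExtension (Literature.Probability.RandomPlanarGeometry.sleTrace ((8:NNReal)/3) ω t)) (D.pt 1)} ≤ β) ∧ (Literature.Probability.Process.preWienerMeasure {ω | ∃ u : NNReal, (u : ℝ) ≤ α₀ ∧ raP / 2 ≤ dist (φ.boundaryExtension (Literature.Probability.RandomPlanarGeometry.sleTrace ((8:NNReal)/3) ω u)) (D.pt 0)} ≤ β) ∧ (Literature.Probability.Process.preWienerMeasure {ω | ∃ u : NNReal, (u : ℝ) ≤ α₀' ∧ rbP / 2 ≤ dist (φ'.boundaryExtension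 (Literature.Probability.RandomPlanarGeometry.sleTrace ((8:NNReal)/3) ω u)) (D.swap.pt 0)} ≤ β) ∧ (∀ (W : NNReal → ℝ) (γ : NNReal → ℂ), Continuous W → Literature.Probability.RandomPlanarGeometry.Loewner.IsGeneratedByCurve W γ → ∃ t : NNReal, t ≤ T ∧ dist (φ.boundaryExtension (γ t)) (D.pt 1) < rb'') ∧ (∀ (W : NNReal → ℝ) (γ : NNReal → ℂ), Continuous W → Literature.Probability.RandomPlanarGeometry.Loewner.IsGeneratedByCurve W γ → ∃ t : NNReal, t ≤ T' ∧ dist (φ'.boundaryExtension (γ t)) (D.swap.pt 1) < ra'') := by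
  intro D φ hφ φ' hφ' Ω _ X P H6 H7 ℓ hℓ β hβ ηr hηr hηrβ
  -- L1/L2: the outer radii `ra, rb ≤ ℓ` from `H6`/`H7` at scale `ℓ / 2`
  obtain ⟨r₁, hr₁, hW₁⟩ := H6 (ℓ / 2) (by positivity) ηr hηr
  obtain ⟨ra, hra, hraℓ, hrar⟩ : ∃ ra : ℝ, 0 < ra ∧ ra ≤ ℓ ∧ ra ≤ r₁ :=
    ⟨min r₁ ℓ, lt_min hr₁ hℓ, min_le_right _ _, min_le_left _ _⟩
  obtain ⟨r₂, hr₂, hW₂⟩ := H7 (ℓ / 2) (by positivity) ηr hηr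
  obtain ⟨rb, hrb, hrbℓ, hrbr⟩ : ∃ rb : ℝ, 0 < rb ∧ rb ≤ ℓ ∧ rb ≤ r₂ :=
    ⟨min r₂ ℓ, lt_min hr₂ hℓ, min_le_right _ _, min_le_left _ _⟩
  -- L3/L4: the inner radii `ra', rb'` and the fine radii `raF, rbF`
  obtain ⟨ra', hra', hW₃⟩ := H6 (ra / 4) (by positivity) ηr hηr
  obtain ⟨rb', hrb', hW₄⟩ := H7 (rb / 4) (by positivity) ηr hηr
  obtain ⟨raF, hraF, hraF4, hraF'⟩ : ∃ raF : ℝ, 0 < raF ∧ raF ≤ ra / 4 ∧ raF ≤ ra' :=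
    ⟨min (ra / 4) ra', lt_min (by positivity) hra', min_le_left _ _, min_le_right _ _⟩
  obtain ⟨rbF, hrbF, hrbF4, hrbF'⟩ : ∃ rbF : ℝ, 0 < rbF ∧ rbF ≤ rb / 4 ∧ rbF ≤ rb' :=
    ⟨min (rb / 4) rb', lt_min (by positivity) hrb', min_le_left _ _, min_le_right _ _⟩
  -- F1/F2: SLE no-escape radius `R2b` and no-return radius `R2a`; `rbP`, `raP`
  obtain ⟨R2b, hR2b, hE₁⟩ := stub_sleNoEscape D φ hφ (rbF / 2) (by positivity) β hβ
  obtain ⟨rbP, hrbP, hrbP2, hrbPF⟩ : ∃ rbP : ℝ, 0 < rbP ∧ rbP ≤ R2b / 2 ∧ rbP ≤ rbF :=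
    ⟨min (R2b / 2) rbF, lt_min (by positivity) hrbF, min_le_left _ _, min_le_right _ _⟩
  obtain ⟨R2a, hR2a, hE₂⟩ := stub_sleNoReturn D φ hφ (raF / 2) (by positivity) β hβ
  obtain ⟨raP, hraP, hraP2, hraPF⟩ : ∃ raP : ℝ, 0 < raP ∧ raP ≤ R2a / 2 ∧ raP ≤ raF :=
    ⟨min (R2a / 2) raF, lt_min (by positivity) hraF, min_le_left _ _, min_le_right _ _⟩
  -- F3/F4/F5: the window radii `rbW`, `rb''`, `ra''`
  obtain ⟨r₇, hr₇, hW₅⟩ := H7 rbP hrbP ηr hηr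
  obtain ⟨rbW, hrbW, hrbW2, hrbW7⟩ : ∃ rbW : ℝ, 0 < rbW ∧ rbW ≤ rbP / 2 ∧ rbW ≤ r₇ :=
    ⟨min (rbP / 2) r₇, lt_min (by positivity) hr₇, min_le_left _ _, min_le_right _ _⟩
  obtain ⟨rb'', hrb'', hW₆⟩ := H7 rbW hrbW ηr hηr
  obtain ⟨ra'', hra'', hW₇⟩ := H6 raP hraP ηr hηr
  -- F6: the SLE range tail index `N` and the forward horizon `T`
  obtain ⟨N, hN⟩ := PathUpgradeRRangeBound.exists_measure_tail_le φ
    (stub_sleHullPackage stub_hullHausdorff D φ hφ).2 (ε := rbW / 2) (by positivity) hβ.ne'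
  obtain ⟨T₀, hT₀⟩ := (stub_latticeDictionary D φ hφ).2 rb'' hrb''
  obtain ⟨T, hNT, hT₀T, h1T⟩ : ∃ T : ℝ≥0, (N : ℝ≥0) ≤ T ∧ T₀ ≤ T ∧ 1 ≤ T :=
    ⟨max (max N T₀) 1, (le_max_left _ _).trans (le_max_left _ _),
      (le_max_right _ _).trans (le_max_left _ _), le_max_right _ _⟩
  -- B1: the backward horizon `T'`
  obtain ⟨T₀', hT₀'⟩ := (stub_latticeDictionary D.swap φ' hφ').2 ra'' hra''
  obtain ⟨T', hT₀T', h1T'⟩ : ∃ T' : ℝ≥0, T₀' ≤ T' ∧ 1 ≤ T' :=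
    ⟨max T₀' 1, le_max_left _ _, le_max_right _ _⟩
  -- F7/B2: the SLE start times, forward and backward
  obtain ⟨α₀, hα₀, hE₄⟩ := stub_sleStart D φ hφ (raP / 2) (by positivity) β hβ
  obtain ⟨α₀', hα₀', hE₅⟩ := stub_sleStart D.swap φ' hφ' (rbP / 2) (by positivity) β hβ
  refine ⟨ra, rb, ra', rb', raF, rbF, R2b, rbP, R2a, raP, rbW, rb'', ra'', N, T, T', α₀, α₀',
    hra, hraℓ, hrb, hrbℓ, hra', hrb', hraF, hraF4, hraF', hrbF, hrbF4, hrbF', hR2b, hrbP, hrbP2,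
    hrbPF, hR2a, hraP, hraP2, hraPF, hrbW, hrbW2, hrb'', hra'', lt_of_lt_of_le zero_lt_one h1T,
    by exact_mod_cast hNT, by exact_mod_cast h1T, lt_of_lt_of_le zero_lt_one h1T',
    by exact_mod_cast h1T', hα₀, hα₀', ?_, ?_, ?_, ?_, ?_, ?_, ?_, hE₁, hE₂, hN, hE₄, hE₅,
    fun W γ hW hgen ↦ hT₀ W γ hW hgen T hT₀T, fun W γ hW hgen ↦ hT₀' W γ hW hgen T' hT₀T'⟩
  · -- W1: radius `ra ≤ r₁`
    filter_upwards [hW₁] with δ h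
    refine (measure_mono fun ω hω ↦ ?_).trans (h.trans hηrβ)
    obtain ⟨s, t, hst, h1, h2⟩ := hω
    exact ⟨s, t, hst, h1, h2.trans hrar⟩
  · -- W2: radius `rb ≤ r₂`
    filter_upwards [hW₂] with δ h
    refine (measure_mono fun ω hω ↦ ?_).trans (h.trans hηrβ)
    obtain ⟨s, t, hst, h1, h2⟩ := hω
    exact ⟨s, t, hst, h1.trans hrbr, h2⟩
  · -- W3
    filter_upwards [hW₃] with δ h using h.trans hηrβ
  · -- W4
    filter_upwards [hW₄] with δ h using h.trans hηrβ
  · -- W5: radius `rbW ≤ r₇`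
    filter_upwards [hW₅] with δ h
    refine (measure_mono fun ω hω ↦ ?_).trans (h.trans hηrβ)
    obtain ⟨s, t, hst, h1, h2⟩ := hω
    exact ⟨s, t, hst, h1.trans hrbW7, h2⟩
  · -- W6
    filter_upwards [hW₆] with δ h using h.trans hηrβ
  · -- W7
    filter_upwards [hW₇] with δ h using h.trans hηrβ

end PathUpgradeRAsm

end Summit.CriticalPhenomena.SAWScalingLimit.Theorems

end
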